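import Mathlib
import Literature.MathematicalPhysics.QuantumFieldTheory.Balaban1983to89.B5Prop11Inverse

/-!
# B5 Prop. 1.1 — pass 6: positivity and the bound from below (1.90) `Δ_a = G⁻¹ ≥ γ₀(Δ + I)`

B5 = T. Bałaban, *Propagators and renormalization transformations for lattice gauge theories. I*,
Commun. Math. Phys. **95** (1984) 17–40 (`Balaban1984PropagatorsI`).  This module is the sixth
kernel pass on node T02.1 (Prop. 1.1 of B5) of the `pub-balaban` reconstruction.  Pass 4
(`B5Prop11Plancherel`) certified the operator-norm bounds (1.89) for the operator `calG = F^* Ĝ F`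
on `ℓ²(T_η; ℂ^d)` whose Fourier blocks are (1.83), with OUR constant `Cst d a`; pass 5
(`B5Prop11Inverse`) certified `𝒢 = 𝒟_a⁻¹` for `calDa = F^* 𝒟̂_a F`, the operator whose Fourier
blocks are the fibers (1.73) of `Δ_a = Δ − ∂P∂* + aQ*Q` ((1.69)).  What remained of the TEXT of
Prop. 1.1 is its last sentence, «This implies the bound from below: Δ_a = G⁻¹ ≥ γ₀(Δ + I). (1.90)».
This pass certifies that inference — positivity of `Δ_a` and of `G`, and (1.89) ⟹ (1.90) — for
these operators, with an explicit constant, zero `sorry`.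

## The printed text (verbatim, B5 p. 33)

«**Proposition 1.1.** The operator G is a symmetric operator on L²(T_η) and
   ‖GJ‖, ‖∇GJ‖, ‖G∇*J‖, ‖∇G∇*J‖, ‖∇∇GJ‖, ‖G∇*∇*J‖ ≤ γ₀⁻¹‖J‖,   (1.89)
with a positive constant γ₀ independent of k, T_η, and depending on d only (if we put a = 1).
This implies the bound from below:
   Δ_a = G⁻¹ ≥ γ₀(Δ + I).   (1.90)»
Same page, after (1.94): «The operator R is given by the formula R = I − P = I − Δ⁻¹Q′*·
(Q′Δ⁻²Q′*)⁻¹Q′Δ⁻¹, so RΔ⁻¹Q′* = 0 and we have R∂*GQ* = 0, QG∂R = 0. (1.95)».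
Also used (quoted in full in `B5Prop11Inverse`/`B5Prop11Plancherel`): p.29 (1.69) «⟨A, Δ_a A⟩ =
⟨A, ∂*∂A⟩ + ⟨A, ∂R∂*A⟩ + a⟨A, Q*QA⟩ = ⟨A, ΔA⟩ − ⟨A, ∂P∂*A⟩ + a⟨A, Q*QA⟩, Δ = ∂*∂ + ∂∂*,
R = I − P,»; p.30 (1.70) «P = Δ⁻¹Q′*(Q′Δ⁻²Q′*)⁻¹Q′Δ⁻¹»; p.21 (1.21) «… where Δ is η-lattice
Laplace operator for scalar functions and ∂* is the divergence operator for vector functions»;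
p.23 (1.31) «Δ(p) = Σ_{μ=1}^d |∂_μ(p)|², ∂_μ(p) = (e^{iηp_μ} − 1)/η».

## Dictionary (as in passes 4–5)

`calG` = `𝒢` (blocks (1.83)); `calDa` = `𝒟_a` (blocks (1.73): `B5Prop11Inverse.Da` at `p′ ≠ 0`,
`Da₀` at `p′ = 0`); `fdiff (fine n M) n ν` = `∇_ν`, the forward difference with the lattice factor
`η⁻¹ = n` (pass 4); `Lap := Σ_ν ∇_ν^* ∇_ν` = the `Δ` of (1.90): the `η`-lattice Laplace operator
acting componentwise on vector functions ((1.21); B5's `Δ = ∂*∂ + ∂∂*` of (1.69)), whose Fourier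
symbol is `Δ(p)·δ_{μν}` ((1.31)) — certified here (`Lap_eq`, `LapSym_emb`: on the coset `p = p′ + l`
the symbol is the `Δ(p′+l)` entering the fibers (1.73)/(1.83)); `I` = `1`; `≥` = the Löwner order
of Hermitian matrices (`Matrix.PosSemidef` of the difference; Mathlib's scoped `MatrixOrder`).

## What is certified (zero `sorry`; axioms `propext`, `Classical.choice`, `Quot.sound`)

* §2, every abstract fiber `F` (`p′ ≠ 0`) under the hypothesis `Δ = Σ_μ|∂_μ|²` (= (1.31)):
  `Nmat_posSemidef` (`Δ − ∂∂* ≥ 0`: with `N = Δ − ∂∂*` Hermitian, `∂*Δ⁻¹∂ = 1` gives `NΔ⁻¹N = N`),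
  `Pproj_isHermitian`, `Pproj_mul_Pproj` (the `P` of (1.70) is an orthogonal projection on the
  fiber), `R_mul_lapSinv_QpH` («so RΔ⁻¹Q′* = 0», p.33), `dRd_posSemidef` (`∂R∂* = (∂R)(∂R)^* ≥ 0`),
  `aQQ_posSemidef`, `Da_eq_three` (the first form of (1.69): `Δ_a = (Δ − ∂∂*) + ∂R∂* + aQ*Q`),
  **`Da_posSemidef`, `G_posSemidef`**: `Δ_a(p′) ≥ 0` and `G(p′) = Δ_a(p′)⁻¹ ≥ 0`; §3
  `Da₀_posSemidef` (`p′ = 0`).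
* §4, operator level: **`calDa_posSemidef`, `calG_posSemidef`** — `𝒟_a ≥ 0` and `𝒢 = 𝒟_a⁻¹ ≥ 0`
  on `ℓ²(T_η; ℂ^d)`.
* §5, THE INFERENCE (1.89) ⟹ (1.90): `opNorm_Vb_calG_VbH_le` (the four bounds `‖𝒢‖, ‖∇_ν𝒢‖,
  ‖𝒢∇_ν′^*‖, ‖∇_ν𝒢∇_ν′^*‖ ≤ Cst(d,a)` of pass 4 as one block bound over `V ∈ {1, ∇_1, …, ∇_d}`),
  `re_form_BGB_le` (`(Δ+I)𝒢(Δ+I) ≤ (d+1)·Cst·(Δ+I)` as forms), `form_LapOne_le` (Cauchy–Schwarz in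
  the `𝒢`-form: `x^*(Δ+I)x = (𝒟_a x)^* 𝒢 ((Δ+I)x)`, `|·|² ≤ [x^*𝒟_a x]·[x^*(Δ+I)𝒢(Δ+I)x]`), whence
  **`lowerBound_re`, `calDa_sub_smul_LapOne_posSemidef`, `smul_LapOne_le_calDa`:
  `𝒟_a ≥ γ·(Σ_ν ∇_ν^*∇_ν + I)` in the Löwner order with `γ = 1/((d+1)·Cst(d,a))`**, for every `d`,
  every `n ≥ 1` (`η = 1/n`), every torus `M`, every `a > 0` — uniform in `η` and `T_η`, depending on
  `d` and `a` only: the printed «independent of k, T_η, and depending on d only (if we put a = 1)».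
* §6: `Lap_eq`, `LapSym_emb` — `Σ_ν ∇_ν^*∇_ν = F^* diag(Δ(p)) F`, `Δ(p) = Σ_ν |∂_ν(p)|²` ((1.31)),
  and on the cosets `Δ(p′+l)` is the `Δ` of (1.73)/(1.83) (`B5Prop11Fiber.Delta_eq`).

## What is NOT certified here (stated, not smuggled)

* The constant.  B5 asserts (1.90) with the SAME `γ₀` as in (1.89); we prove it with
  `γ = 1/((d+1)·Cst(d,a))`, `Cst(d,a) = max(gamma0 d a, 1/a, 1)` OUR (1.89)-constant of pass 4
  (`gamma0` the fiber constant of `B5Prop11Fiber`; no value of `γ₀` is attributed to the paper).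
  The factor `d + 1` comes from bounding `(Δ+I)𝒢(Δ+I)` blockwise through componentwise bounds; it
  depends on `d` only, as printed.  Only the first four norms of (1.89) are used.
* As in pass 5: that `calDa` IS the position-space operator `Δ − ∂P∂* + aQ*Q` of (1.69) acting on
  `A : T_η → ℂ^d` (block averages `Q_k`, `Q′_k` in position space; `P` = the orthogonal projection of
  (1.69)) is not formalised — `calDa` is DEFINED by its printed Fourier blocks (1.73).  Likewise
  `Lap` is DEFINED as `Σ_ν ∇_ν^*∇_ν` (the componentwise `η`-lattice Laplacian of (1.21)); the
  lattice identity `∂*∂ + ∂∂* = Σ_ν ∇_ν^*∇_ν ⊗ 1` behind «Δ = ∂*∂ + ∂∂*» of (1.69) is not typed —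
  what IS typed is that the symbol of `Lap` is (1.31) (`Lap_eq`).
* Erratum to the module docstring of `B5Prop11Inverse` (pass 5, list "NOT certified"): it glosses
  (1.90) as an exponential-decay bound `|G(x,x′)| ≤ C e^{−δ|x−x′|}`; (1.90) is the bound from below
  quoted above, and the statement of Prop. 1.1 (p. 33) contains no decay bound.  Nothing typed in
  pass 5 is affected.

Value: a kernel certificate of the printed inference (1.89) ⟹ (1.90) (and of `Δ_a ≥ 0`, `G ≥ 0`)
for the operator with Fourier blocks (1.73)/(1.83), with our constant — NOT summit progress.
-/

open scoped BigOperators Matrix ComplexConjugate ComplexOrder Matrix.Norms.L2Operator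
open Finset Complex

namespace Literature.MathematicalPhysics.QuantumFieldTheory.Balaban1983to89.B5Prop11Lower

open Literature.MathematicalPhysics.QuantumFieldTheory.Balaban1983to89.B4Strip
open Literature.MathematicalPhysics.QuantumFieldTheory.Balaban1983to89.B5Prop11Leaves
open Literature.MathematicalPhysics.QuantumFieldTheory.Balaban1983to89.B5Prop11Bound
open Literature.MathematicalPhysics.QuantumFieldTheory.Balaban1983to89.B5Prop11Fiber
open Literature.MathematicalPhysics.QuantumFieldTheory.Balaban1983to89.B5Prop11Plancherel
open Literature.MathematicalPhysics.QuantumFieldTheory.Balaban1983to89.B5Prop11Inverse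

noncomputable section

/-! ## §1 `ℓ²` toolkit: quadratic forms, Cauchy–Schwarz, Gram factors -/

section VecTools

variable {m : Type*} [Fintype m] [DecidableEq m]

/-- the `ℓ²` mass `Σ_i |u_i|²` of a vector. [folklore] -/
def nsq (u : m → ℂ) : ℝ := ∑ i, ‖u i‖ ^ 2

omit [DecidableEq m] in
/-- `Σ_i |u_i|² ≥ 0`. [folklore] -/
theorem nsq_nonneg (u : m → ℂ) : 0 ≤ nsq u :=
  Finset.sum_nonneg fun i _ => by positivity

omit [DecidableEq m] in
/-- `u^* u = Σ_i |u_i|²` as a complex number. [folklore] -/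
theorem star_dotProduct_self (u : m → ℂ) : star u ⬝ᵥ u = ((nsq u : ℝ) : ℂ) := by
  simp only [dotProduct, Pi.star_apply, nsq, Complex.ofReal_sum, Complex.ofReal_pow,
    Complex.star_def]
  refine Finset.sum_congr rfl fun i _ => ?_
  rw [Complex.conj_mul' (u i)]

omit [DecidableEq m] in
/-- Cauchy–Schwarz `|u^* v| ≤ ‖u‖ ‖v‖` for the standard inner product. [folklore] -/
theorem norm_star_dotProduct_le (u v : m → ℂ) :
    ‖star u ⬝ᵥ v‖ ≤ Real.sqrt (nsq u) * Real.sqrt (nsq v) := by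
  have h := norm_inner_le_norm (𝕜 := ℂ) (WithLp.toLp 2 u : EuclideanSpace ℂ m)
    (WithLp.toLp 2 v : EuclideanSpace ℂ m)
  rw [EuclideanSpace.inner_toLp_toLp, dotProduct_comm, EuclideanSpace.norm_eq,
    EuclideanSpace.norm_eq] at h
  simpa [nsq] using h

/-- `Σ_i |(X w)_i|² ≤ ‖X‖² Σ_i |w_i|²` (operator norm). [folklore] -/
theorem nsq_mulVec_le (X : Matrix m m ℂ) (w : m → ℂ) : nsq (X *ᵥ w) ≤ ‖X‖ ^ 2 * nsq w := by
  have h := sq_norm_apply_le X w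
  simpa [nsq, Matrix.mulVec, dotProduct] using h

/-- `‖X w‖ ≤ ‖X‖ ‖w‖`. [folklore] -/
theorem sqrt_nsq_mulVec_le (X : Matrix m m ℂ) (w : m → ℂ) :
    Real.sqrt (nsq (X *ᵥ w)) ≤ ‖X‖ * Real.sqrt (nsq w) := by
  calc Real.sqrt (nsq (X *ᵥ w)) ≤ Real.sqrt (‖X‖ ^ 2 * nsq w) :=
        Real.sqrt_le_sqrt (nsq_mulVec_le X w)
    _ = ‖X‖ * Real.sqrt (nsq w) := by
        rw [Real.sqrt_mul (sq_nonneg _), Real.sqrt_sq (norm_nonneg _)]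

/-- `|u^* X w| ≤ ‖X‖ ‖u‖ ‖w‖`. [folklore] -/
theorem norm_form_le (X : Matrix m m ℂ) (u w : m → ℂ) :
    ‖star u ⬝ᵥ (X *ᵥ w)‖ ≤ ‖X‖ * (Real.sqrt (nsq u) * Real.sqrt (nsq w)) := by
  calc ‖star u ⬝ᵥ (X *ᵥ w)‖ ≤ Real.sqrt (nsq u) * Real.sqrt (nsq (X *ᵥ w)) :=
        norm_star_dotProduct_le u _
    _ ≤ Real.sqrt (nsq u) * (‖X‖ * Real.sqrt (nsq w)) := by
        gcongr
        exact sqrt_nsq_mulVec_le X w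
    _ = ‖X‖ * (Real.sqrt (nsq u) * Real.sqrt (nsq w)) := by ring

omit [DecidableEq m] in
/-- the form of a Gram sandwich: `x^* (P^* X Q) x = (Px)^* X (Qx)`. [folklore] -/
theorem form_sandwich (P X Q : Matrix m m ℂ) (x : m → ℂ) :
    star x ⬝ᵥ ((Pᴴ * X * Q) *ᵥ x) = star (P *ᵥ x) ⬝ᵥ (X *ᵥ (Q *ᵥ x)) := by
  rw [← Matrix.mulVec_mulVec, ← Matrix.mulVec_mulVec, Matrix.dotProduct_mulVec,
    Matrix.vecMul_conjTranspose, star_star]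

omit [DecidableEq m] in
/-- `x^* (P^*P X Q^*Q) x = (Px)^* (P X Q^*) (Qx)`. [folklore] -/
theorem form_sandwich5 (P X Q : Matrix m m ℂ) (x : m → ℂ) :
    star x ⬝ᵥ ((Pᴴ * P * X * (Qᴴ * Q)) *ᵥ x) = star (P *ᵥ x) ⬝ᵥ ((P * X * Qᴴ) *ᵥ (Q *ᵥ x)) := by
  have : Pᴴ * P * X * (Qᴴ * Q) = Pᴴ * (P * X * Qᴴ) * Q := by simp only [Matrix.mul_assoc]
  rw [this, form_sandwich]

omit [DecidableEq m] in
/-- `x^* (V^* V) x = Σ_i |(Vx)_i|²`. [folklore] -/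
theorem form_gram (V : Matrix m m ℂ) (x : m → ℂ) :
    star x ⬝ᵥ ((Vᴴ * V) *ᵥ x) = ((nsq (V *ᵥ x) : ℝ) : ℂ) := by
  rw [← Matrix.mulVec_mulVec, Matrix.dotProduct_mulVec, Matrix.vecMul_conjTranspose, star_star,
    star_dotProduct_self]

open scoped MatrixOrder in
/-- a positive semidefinite complex matrix is a Gram matrix `B^* B`. [folklore] -/
theorem exists_gram {A : Matrix m m ℂ} (hA : A.PosSemidef) : ∃ B : Matrix m m ℂ, A = Bᴴ * B := by
  obtain ⟨B, hB⟩ := CStarAlgebra.nonneg_iff_eq_star_mul_self.mp hA.nonneg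
  exact ⟨B, by rw [hB, Matrix.star_eq_conjTranspose]⟩

/-- Cauchy–Schwarz for the semi-inner product of a positive semidefinite matrix:
`|x^* G y|² ≤ re(x^* G x) · re(y^* G y)`. [folklore] -/
theorem norm_sq_form_le_of_posSemidef {G : Matrix m m ℂ} (hG : G.PosSemidef) (x y : m → ℂ) :
    ‖star x ⬝ᵥ (G *ᵥ y)‖ ^ 2 ≤ (star x ⬝ᵥ (G *ᵥ x)).re * (star y ⬝ᵥ (G *ᵥ y)).re := by
  obtain ⟨B, rfl⟩ := exists_gram hG
  have key : ∀ x y : m → ℂ, star x ⬝ᵥ ((Bᴴ * B) *ᵥ y) = star (B *ᵥ x) ⬝ᵥ (B *ᵥ y) := by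
    intro x y
    rw [← Matrix.mulVec_mulVec, Matrix.dotProduct_mulVec, Matrix.vecMul_conjTranspose, star_star]
  rw [key, key, key, star_dotProduct_self, star_dotProduct_self, Complex.ofReal_re,
    Complex.ofReal_re]
  have h := norm_star_dotProduct_le (B *ᵥ x) (B *ᵥ y)
  calc ‖star (B *ᵥ x) ⬝ᵥ (B *ᵥ y)‖ ^ 2
        ≤ (Real.sqrt (nsq (B *ᵥ x)) * Real.sqrt (nsq (B *ᵥ y))) ^ 2 :=
          pow_le_pow_left₀ (norm_nonneg _) h 2
    _ = nsq (B *ᵥ x) * nsq (B *ᵥ y) := by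
          rw [mul_pow, Real.sq_sqrt (nsq_nonneg _), Real.sq_sqrt (nsq_nonneg _)]

omit [DecidableEq m] in
/-- `r • (Q^* Q)` is positive semidefinite for `r ≥ 0`. [folklore] -/
theorem smul_gram_posSemidef {p : Type*} [Fintype p] (r : ℝ) (hr : 0 ≤ r) (Q : Matrix p m ℂ) :
    ((r : ℂ) • (Qᴴ * Q)).PosSemidef := by
  have e : (r : ℂ) • (Qᴴ * Q) = ((Real.sqrt r : ℂ) • Q)ᴴ * ((Real.sqrt r : ℂ) • Q) := by
    rw [Matrix.conjTranspose_smul, Matrix.smul_mul, Matrix.mul_smul, smul_smul]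
    have h : star (Real.sqrt r : ℂ) * (Real.sqrt r : ℂ) = (r : ℂ) := by
      rw [Complex.star_def, Complex.conj_ofReal, ← Complex.ofReal_mul, Real.mul_self_sqrt hr]
    rw [h]
  rw [e]
  exact Matrix.posSemidef_conjTranspose_mul_self _

/-- a block-diagonal matrix with positive semidefinite blocks is positive semidefinite. [folklore] -/
theorem posSemidef_blockDiagonal {o : Type*} [Fintype o] [DecidableEq o]
    (B : o → Matrix m m ℂ) (h : ∀ k, (B k).PosSemidef) : (Matrix.blockDiagonal B).PosSemidef := by
  choose C hC using fun k => exists_gram (h k)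
  have e : Matrix.blockDiagonal B = (Matrix.blockDiagonal C)ᴴ * Matrix.blockDiagonal C := by
    rw [Matrix.blockDiagonal_conjTranspose, ← Matrix.blockDiagonal_mul]
    congr 1
    funext k
    exact hC k
  rw [e]
  exact Matrix.posSemidef_conjTranspose_mul_self _

omit [DecidableEq m] in
/-- the form of a positive semidefinite matrix is real: `x^* D x = re(x^* D x)`. [folklore] -/
theorem form_eq_re_of_posSemidef {D : Matrix m m ℂ} (hD : D.PosSemidef) (x : m → ℂ) :
    star x ⬝ᵥ (D *ᵥ x) = ((star x ⬝ᵥ (D *ᵥ x)).re : ℂ) := by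
  have hz := hD.dotProduct_mulVec_nonneg x
  obtain ⟨_, him⟩ := Complex.nonneg_iff.mp hz
  exact Complex.ext (by simp) (by simpa using him.symm)

omit [DecidableEq m] in
/-- `re(x^* D x) ≥ 0` for positive semidefinite `D`. [folklore] -/
theorem form_re_nonneg_of_posSemidef {D : Matrix m m ℂ} (hD : D.PosSemidef) (x : m → ℂ) :
    0 ≤ (star x ⬝ᵥ (D *ᵥ x)).re :=
  (Complex.nonneg_iff.mp (hD.dotProduct_mulVec_nonneg x)).1

end VecTools

/-! ## §2 Positivity of the fiber of `Δ_a` ((1.69): `∂*∂ ≥ 0`, `∂R∂* ≥ 0`, `aQ*Q ≥ 0`) -/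

section Abstract

variable {Λ : Type*} [Fintype Λ] [DecidableEq Λ] {d : ℕ} (F : Fiber Λ d)

/-- `Δ⁻¹` on vector functions of the fiber: `diag(1/Δ(p′+l))` (componentwise, (1.21)).
[cite: Balaban1984PropagatorsI, (1.21) p.21, p.22] -/
def lapVinv : Matrix (Λ × Fin d) (Λ × Fin d) ℂ := Matrix.diagonal fun i => 1 / (F.Δ i.1 : ℂ)

/-- `Δ Δ⁻¹ = 1` on vector functions of a fiber `p′ ≠ 0`. [folklore] -/
theorem lapV_mul_lapVinv : lapV F * lapVinv F = 1 := by
  rw [lapV, lapVinv, Matrix.diagonal_mul_diagonal, ← Matrix.diagonal_one]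
  congr 1
  funext i
  have hΔ : (F.Δ i.1 : ℂ) ≠ 0 := by exact_mod_cast (F.Δ_pos i.1).ne'
  field_simp

/-- `Δ⁻¹ Δ = 1` on vector functions of a fiber `p′ ≠ 0`. [folklore] -/
theorem lapVinv_mul_lapV : lapVinv F * lapV F = 1 := by
  rw [lapV, lapVinv, Matrix.diagonal_mul_diagonal, ← Matrix.diagonal_one]
  congr 1
  funext i
  have hΔ : (F.Δ i.1 : ℂ) ≠ 0 := by exact_mod_cast (F.Δ_pos i.1).ne'
  field_simp

/-- `Δ⁻¹ ≥ 0` on the fiber. [folklore] -/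
theorem lapVinv_posSemidef : (lapVinv F).PosSemidef := by
  refine Matrix.PosSemidef.diagonal fun i => ?_
  have h : (0 : ℝ) ≤ 1 / F.Δ i.1 := by
    have := F.Δ_pos i.1
    positivity
  have e : (1 / (F.Δ i.1 : ℂ)) = ((1 / F.Δ i.1 : ℝ) : ℂ) := by push_cast; ring
  simp only [Pi.zero_apply]
  rw [e]
  exact Complex.zero_le_real.mpr h

/-- `∂* Δ⁻¹ ∂ = 1` on scalar functions of the fiber when `Δ = Σ_μ |∂_μ|²` ((1.31)).
[cite: Balaban1984PropagatorsI, (1.31) p.23] -/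
theorem dOpH_lapVinv_dOp (hΔe : ∀ l, F.Δ l = ∑ μ, ‖F.e μ l‖ ^ 2) :
    (dOp F)ᴴ * lapVinv F * dOp F = 1 := by
  rw [Matrix.mul_assoc]
  ext l l'
  rw [Matrix.mul_apply, Fintype.sum_prod_type, Finset.sum_eq_single l]
  · have hΔ : (F.Δ l : ℂ) ≠ 0 := by exact_mod_cast (F.Δ_pos l).ne'
    by_cases h : l = l'
    · subst h
      simp only [Matrix.conjTranspose_apply, dOp, lapVinv, Matrix.diagonal_mul, Complex.star_def,
        Matrix.one_apply_eq, ↓reduceIte]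
      have hs : ∑ μ, conj (F.e μ l) * (1 / (F.Δ l : ℂ) * F.e μ l)
          = (∑ μ, F.e μ l * conj (F.e μ l)) / (F.Δ l : ℂ) := by
        rw [Finset.sum_div]
        exact Finset.sum_congr rfl fun μ _ => by ring
      rw [hs, ← Δ_cast F hΔe l, div_self hΔ]
    · simp [Matrix.conjTranspose_apply, dOp, lapVinv, Matrix.diagonal_mul, h, Matrix.one_apply_ne h]
  · intro b _ hb
    simp [Matrix.conjTranspose_apply, dOp, hb]
  · intro h
    exact absurd (Finset.mem_univ l) h

/-- `N := Δ − ∂∂*` on vector functions of the fiber (`= ∂*∂`, the field-strength part of (1.69),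
by `Δ = ∂*∂ + ∂∂*`). [cite: Balaban1984PropagatorsI, (1.69) p.29] -/
def Nmat : Matrix (Λ × Fin d) (Λ × Fin d) ℂ := lapV F - dOp F * (dOp F)ᴴ

/-- `Δ` on vector functions is Hermitian (real diagonal). [folklore] -/
theorem lapV_isHermitian : (lapV F).IsHermitian := by
  rw [lapV]
  refine Matrix.isHermitian_diagonal_of_self_adjoint _ (funext fun i => ?_)
  simp [Pi.star_apply, Complex.conj_ofReal]

/-- `N = Δ − ∂∂*` is Hermitian. [folklore] -/
theorem Nmat_isHermitian : (Nmat F).IsHermitian :=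
  (lapV_isHermitian F).sub (Matrix.isHermitian_mul_conjTranspose_self _)

/-- the projection identity `N Δ⁻¹ N = N` (per mode, `Δ I − e e^*` is `Δ` times the orthogonal
projection onto `e^⊥`, as `|e|² = Δ`). [folklore] -/
theorem Nmat_sandwich (hΔe : ∀ l, F.Δ l = ∑ μ, ‖F.e μ l‖ ^ 2) :
    Nmat F * lapVinv F * Nmat F = Nmat F := by
  have h1 := lapV_mul_lapVinv F
  have h2 := lapVinv_mul_lapV F
  have h3 := dOpH_lapVinv_dOp F hΔe
  have h4 : dOp F * (dOp F)ᴴ * lapVinv F * (dOp F * (dOp F)ᴴ) = dOp F * (dOp F)ᴴ := by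
    calc dOp F * (dOp F)ᴴ * lapVinv F * (dOp F * (dOp F)ᴴ)
          = dOp F * ((dOp F)ᴴ * lapVinv F * dOp F) * (dOp F)ᴴ := by
            simp only [Matrix.mul_assoc]
      _ = dOp F * (dOp F)ᴴ := by rw [h3, Matrix.mul_one]
  have h5 : dOp F * (dOp F)ᴴ * lapVinv F * lapV F = dOp F * (dOp F)ᴴ := by
    rw [Matrix.mul_assoc, h2, Matrix.mul_one]
  rw [Nmat, Matrix.sub_mul, h1, Matrix.sub_mul, Matrix.one_mul, Matrix.mul_sub, h5, h4, sub_self,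
    sub_zero]

/-- `∂*∂ = Δ − ∂∂* ≥ 0` on vector functions of the fiber (the first term of (1.69)).
[cite: Balaban1984PropagatorsI, (1.69) p.29 (proof ours)] -/
theorem Nmat_posSemidef (hΔe : ∀ l, F.Δ l = ∑ μ, ‖F.e μ l‖ ^ 2) : (Nmat F).PosSemidef := by
  have h := (lapVinv_posSemidef F).conjTranspose_mul_mul_same (Nmat F)
  rwa [(Nmat_isHermitian F).eq, Nmat_sandwich F hΔe] at h

/-- `P` of (1.70) is Hermitian. [cite: Balaban1984PropagatorsI, (1.69)-(1.70) pp.29-30 (proof ours)] -/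
theorem Pproj_isHermitian : (Pproj F).IsHermitian := by
  refine Matrix.IsHermitian.ext fun l l' => ?_
  rw [Pproj_apply, Pproj_apply]
  simp only [Complex.star_def, map_div₀, map_mul, Complex.conj_conj, Complex.conj_ofReal]
  ring

/-- `P` of (1.70) is idempotent: `P² = P` (so `P` is an orthogonal projection and `R = I − P`
of (1.69) is one too). [cite: Balaban1984PropagatorsI, (1.69)-(1.70) pp.29-30 (proof ours)] -/
theorem Pproj_mul_Pproj : Pproj F * Pproj F = Pproj F := by
  ext l l''
  rw [Matrix.mul_apply, Pproj_apply]
  simp_rw [Pproj_apply]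
  have hX : (F.X : ℂ) ≠ 0 := by exact_mod_cast F.X_pos.ne'
  have hΔ : (F.Δ l : ℂ) ≠ 0 := by exact_mod_cast (F.Δ_pos l).ne'
  have hΔ'' : (F.Δ l'' : ℂ) ≠ 0 := by exact_mod_cast (F.Δ_pos l'').ne'
  have hterm : ∀ l', conj (F.u l) * F.u l' / ((F.Δ l : ℂ) * (F.X : ℂ) * (F.Δ l' : ℂ))
      * (conj (F.u l') * F.u l'' / ((F.Δ l' : ℂ) * (F.X : ℂ) * (F.Δ l'' : ℂ)))
      = conj (F.u l) * F.u l'' / ((F.Δ l : ℂ) * (F.X : ℂ) * (F.Δ l'' : ℂ))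
        * ((F.u l' * conj (F.u l') / (F.Δ l' : ℂ) ^ 2) / (F.X : ℂ)) := by
    intro l'
    have hΔ' : (F.Δ l' : ℂ) ≠ 0 := by exact_mod_cast (F.Δ_pos l').ne'
    field_simp
  rw [Finset.sum_congr rfl fun l' _ => hterm l', ← Finset.mul_sum, ← Finset.sum_div, ← X_cast,
    div_self hX, mul_one]

/-- p.33: «R = I − P = I − Δ⁻¹Q′*·(Q′Δ⁻²Q′*)⁻¹Q′Δ⁻¹, so RΔ⁻¹Q′* = 0» — on the fiber.
[cite: Balaban1984PropagatorsI, p.33 (after (1.94))] -/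
theorem R_mul_lapSinv_QpH : (1 - Pproj F) * (lapSinv F * (Qp F)ᴴ) = 0 := by
  have hX : (F.X : ℂ) ≠ 0 := by exact_mod_cast F.X_pos.ne'
  have hS : Qp F * (lapSinv F * (lapSinv F * (Qp F)ᴴ)) = (F.X : ℂ) • (1 : Matrix Unit Unit ℂ) := by
    simpa only [Matrix.mul_assoc] using Qp_lapSinv_sq_Qp F
  have hP : Pproj F * (lapSinv F * (Qp F)ᴴ) = lapSinv F * (Qp F)ᴴ := by
    rw [Pproj, inv_Qp_lapSinv_sq_Qp]
    simp only [Matrix.mul_assoc, Matrix.smul_mul, Matrix.one_mul, Matrix.mul_smul]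
    rw [hS, Matrix.mul_smul, Matrix.mul_one, Matrix.mul_smul, smul_smul]
    rw [show 1 / (F.X : ℂ) * (F.X : ℂ) = 1 by field_simp, one_smul]
  rw [Matrix.sub_mul, Matrix.one_mul, hP, sub_self]

/-- `∂R∂* = ∂(I − P)∂* ≥ 0` on the fiber (the second term of (1.69)), since `R` is an orthogonal
projection. [cite: Balaban1984PropagatorsI, (1.69) p.29 (proof ours)] -/
theorem dRd_posSemidef : (dOp F * (1 - Pproj F) * (dOp F)ᴴ).PosSemidef := by
  have hR : (1 - Pproj F)ᴴ = 1 - Pproj F := by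
    rw [Matrix.conjTranspose_sub, Matrix.conjTranspose_one, (Pproj_isHermitian F).eq]
  have hRR : (1 - Pproj F) * (1 - Pproj F) = 1 - Pproj F := by
    rw [Matrix.sub_mul, Matrix.one_mul, Matrix.mul_sub, Matrix.mul_one, Pproj_mul_Pproj, sub_self,
      sub_zero]
  have e : dOp F * (1 - Pproj F) * (dOp F)ᴴ
      = (dOp F * (1 - Pproj F)) * (dOp F * (1 - Pproj F))ᴴ := by
    rw [Matrix.conjTranspose_mul, hR]
    calc dOp F * (1 - Pproj F) * (dOp F)ᴴ
          = dOp F * ((1 - Pproj F) * (1 - Pproj F)) * (dOp F)ᴴ := by rw [hRR]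
      _ = dOp F * (1 - Pproj F) * ((1 - Pproj F) * (dOp F)ᴴ) := by simp only [Matrix.mul_assoc]
  rw [e]
  exact Matrix.posSemidef_self_mul_conjTranspose _

/-- `aQ*Q ≥ 0` on the fiber (the third term of (1.69)). [folklore] -/
theorem aQQ_posSemidef : ((F.a : ℂ) • ((Qv F)ᴴ * Qv F)).PosSemidef :=
  smul_gram_posSemidef F.a F.a_pos.le (Qv F)

/-- (1.69) regrouped: `Δ_a = (Δ − ∂∂*) + ∂(I − P)∂* + aQ*Q` on the fiber. [folklore] -/
theorem Da_eq_three :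
    Da F = Nmat F + dOp F * (1 - Pproj F) * (dOp F)ᴴ + (F.a : ℂ) • ((Qv F)ᴴ * Qv F) := by
  rw [Da, Nmat, Matrix.mul_sub, Matrix.mul_one, Matrix.sub_mul]
  abel

/-- POSITIVITY OF THE FIBER: `Δ_a(p′) ≥ 0` for every abstract fiber with `Δ = Σ_μ |∂_μ|²`
((1.69): a sum of three nonnegative forms). [cite: Balaban1984PropagatorsI, (1.69) p.29, (1.90)
p.33 (proof ours)] -/
theorem Da_posSemidef (hΔe : ∀ l, F.Δ l = ∑ μ, ‖F.e μ l‖ ^ 2) : (Da F).PosSemidef := by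
  rw [Da_eq_three]
  exact ((Nmat_posSemidef F hΔe).add (dRd_posSemidef F)).add (aQQ_posSemidef F)

/-- hence `G(p′) = Δ_a(p′)⁻¹ ≥ 0` on every fiber `p′ ≠ 0`. [folklore] -/
theorem G_posSemidef (hΔe : ∀ l, F.Δ l = ∑ μ, ‖F.e μ l‖ ^ 2) : F.G.PosSemidef := by
  rw [G_eq_inv F hΔe]
  exact (Da_posSemidef F hΔe).inv

end Abstract

/-! ## §3 The zero fiber and the concrete fibers -/

section Zero

variable {Λ : Type*} [Fintype Λ] [DecidableEq Λ] {d : ℕ}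

/-- `Δ_a(0) = Δ + aQ*Q ≥ 0` on the fiber `p′ = 0` whenever `Δ ≥ 0`, `a ≥ 0`. [folklore] -/
theorem Da₀_posSemidef (o : Λ) {a : ℝ} (ha : 0 ≤ a) {Δ : Λ → ℝ} (hΔ : ∀ l, 0 ≤ Δ l) :
    (Da₀ (d := d) o a Δ).PosSemidef := by
  rw [Da₀]
  refine Matrix.PosSemidef.add ?_ (smul_gram_posSemidef a ha _)
  refine Matrix.PosSemidef.diagonal fun i => ?_
  simp only [Pi.zero_apply]
  exact Complex.zero_le_real.mpr (hΔ i.1)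

end Zero

/-! ## §4 Operator level: `𝒟_a ≥ 0`, `𝒢 = 𝒟_a⁻¹ ≥ 0` on `ℓ²(T_η; ℂ^d)` -/

section Operator

variable {d : ℕ} (n : ℕ) [NeZero n] (hn : 1 ≤ n) (M : Fin d → ℕ) [hM : ∀ μ, NeZero (M μ)]
  (a : ℝ) (ha : 0 < a)

/-- every Fourier block of `𝒟_a` is positive semidefinite (incl. `p′ = 0`). [folklore] -/
theorem DaBlocks_posSemidef (q : Tor M) : (DaBlocks n hn M a ha q).PosSemidef := by
  by_cases hq : q = 0
  · subst hq
    simp only [DaBlocks, dif_pos]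
    refine Da₀_posSemidef _ ha.le fun k => ?_
    rw [Delta_eq n k 0]
    exact Finset.sum_nonneg fun μ _ => by positivity
  · simp only [DaBlocks, dif_neg hq]
    exact Da_posSemidef _ (fun k => Delta_eq n k _)

/-- `𝒟̂_a ≥ 0` in momentum space. [folklore] -/
theorem calDahat_posSemidef : (calDahat n hn M a ha).PosSemidef := by
  rw [calDahat, Matrix.reindex_symm, Matrix.reindex_apply, Equiv.symm_symm]
  exact (posSemidef_blockDiagonal _ (DaBlocks_posSemidef n hn M a ha)).submatrix _

/-- POSITIVITY: `𝒟_a = F^* 𝒟̂_a F ≥ 0` on `ℓ²(T_η; ℂ^d)`. [cite: Balaban1984PropagatorsI, (1.69)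
p.29, (1.90) p.33 (proof ours)] -/
theorem calDa_posSemidef : (calDa n hn M a ha).PosSemidef := by
  rw [calDa, Matrix.star_eq_conjTranspose]
  exact (calDahat_posSemidef n hn M a ha).conjTranspose_mul_mul_same _

/-- `𝒢 = 𝒟_a⁻¹ ≥ 0`. [cite: Balaban1984PropagatorsI, (1.90) p.33 «Δ_a = G⁻¹» (proof ours)] -/
theorem calG_posSemidef : (calG n hn M a ha).PosSemidef := by
  rw [calG_eq_inv]
  exact (calDa_posSemidef n hn M a ha).inv

/-! ## §5 The bound from below (1.90): `𝒟_a ≥ γ (Σ_ν ∇_ν^*∇_ν + 1)`, `γ = 1/((d+1)·Cst(d,a))` -/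

/-- `Σ_ν ∇_ν^* ∇_ν`: the (positive) lattice Laplace operator on vector functions on `T_η`,
componentwise ((1.21); its symbol is `Δ(p) = Σ_μ |∂_μ(p)|²` of (1.31)) — the `Δ` of (1.90).
[cite: Balaban1984PropagatorsI, (1.21) p.21, (1.31) p.23, (1.90) p.33] -/
def Lap : Matrix (Tor (fine n M) × Fin d) (Tor (fine n M) × Fin d) ℂ :=
  ∑ ν, (fdiff (fine n M) (n : ℂ) ν)ᴴ * fdiff (fine n M) (n : ℂ) ν

/-- the family `V_α`, `α ∈ {none} ∪ Fin d`: `V_none = 1`, `V_ν = ∇_ν`, so that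
`Σ_α V_α^* V_α = Δ + I`. [folklore] -/
def Vb : Option (Fin d) → Matrix (Tor (fine n M) × Fin d) (Tor (fine n M) × Fin d) ℂ
  | none => 1
  | some ν => fdiff (fine n M) (n : ℂ) ν

/-- `Σ_α V_α^* V_α = Δ + I`. [folklore] -/
theorem sum_VbH_Vb : ∑ α, (Vb n M α)ᴴ * Vb n M α = Lap n M + 1 := by
  rw [Fintype.sum_option]
  simp only [Vb, Matrix.conjTranspose_one, Matrix.mul_one, Lap]
  rw [add_comm]

/-- `Δ + I` is Hermitian. [folklore] -/
theorem LapOne_isHermitian : (Lap n M + 1).IsHermitian := by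
  rw [← sum_VbH_Vb]
  exact Finset.sum_induction _ (fun X => Matrix.IsHermitian X) (fun _ _ ha hb => ha.add hb)
    Matrix.isHermitian_zero (fun α _ => Matrix.isHermitian_conjTranspose_mul_self _)

/-- `x^* (Δ + I) x = Σ_α ‖V_α x‖²` (as a complex number). [folklore] -/
theorem form_LapOne (A : Tor (fine n M) × Fin d → ℂ) :
    star A ⬝ᵥ ((Lap n M + 1) *ᵥ A) = ((∑ α, nsq (Vb n M α *ᵥ A) : ℝ) : ℂ) := by
  rw [← sum_VbH_Vb, Matrix.sum_mulVec, dotProduct_sum, Complex.ofReal_sum]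
  exact Finset.sum_congr rfl fun α _ => form_gram _ _

/-- `1 ≤ Cst(d,a)`. [folklore] -/
theorem one_le_Cst : 1 ≤ Cst d a := le_max_of_le_right (le_max_right _ _)

/-- the four (1.89) bounds of pass 4 as ONE block bound: `‖V_α 𝒢 V_β^*‖ ≤ Cst(d,a)` for all
`α, β` (`‖𝒢‖`, `‖∇_ν𝒢‖`, `‖𝒢∇_ν'^*‖`, `‖∇_ν𝒢∇_ν'^*‖`). [cite: Balaban1984PropagatorsI, Prop. 1.1
(1.89) p.33 (kernel version of pass 4)] -/
theorem opNorm_Vb_calG_VbH_le (α β : Option (Fin d)) :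
    ‖Vb n M α * calG n hn M a ha * (Vb n M β)ᴴ‖ ≤ Cst d a := by
  rcases α with _ | ν <;> rcases β with _ | ν'
  · simpa [Vb] using opNorm_calG_le n hn M a ha
  · simpa [Vb, Matrix.star_eq_conjTranspose] using opNorm_calG_star_fdiff_le n hn M a ha ν'
  · simpa [Vb] using opNorm_fdiff_calG_le n hn M a ha ν
  · simpa [Vb, Matrix.star_eq_conjTranspose] using opNorm_fdiff_calG_star_fdiff_le n hn M a ha ν ν'

/-- the block estimate: `re x^*(Δ+I)𝒢(Δ+I)x ≤ (d+1)·Cst · Σ_α ‖V_α x‖²`, i.e.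
`(Δ+I)𝒢(Δ+I) ≤ (d+1) Cst (Δ+I)`. [folklore] -/
theorem re_form_BGB_le (A : Tor (fine n M) × Fin d → ℂ) :
    (star A ⬝ᵥ (((Lap n M + 1) * calG n hn M a ha * (Lap n M + 1)) *ᵥ A)).re
      ≤ ((d + 1 : ℝ) * Cst d a) * ∑ α, nsq (Vb n M α *ᵥ A) := by
  set G := calG n hn M a ha with hG
  set s : Option (Fin d) → ℝ := fun α => Real.sqrt (nsq (Vb n M α *ᵥ A)) with hs
  have hs0 : ∀ α, 0 ≤ s α := fun α => Real.sqrt_nonneg _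
  have hs2 : ∀ α, s α ^ 2 = nsq (Vb n M α *ᵥ A) := fun α => Real.sq_sqrt (nsq_nonneg _)
  have hexp : star A ⬝ᵥ (((Lap n M + 1) * G * (Lap n M + 1)) *ᵥ A)
      = ∑ α, ∑ β, star (Vb n M α *ᵥ A) ⬝ᵥ
          ((Vb n M α * G * (Vb n M β)ᴴ) *ᵥ (Vb n M β *ᵥ A)) := by
    rw [← sum_VbH_Vb, Finset.sum_mul, Finset.sum_mul, Matrix.sum_mulVec, dotProduct_sum]
    refine Finset.sum_congr rfl fun α _ => ?_
    rw [Finset.mul_sum, Matrix.sum_mulVec, dotProduct_sum]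
    refine Finset.sum_congr rfl fun β _ => ?_
    exact form_sandwich5 _ _ _ _
  have hterm : ∀ α β, (star (Vb n M α *ᵥ A) ⬝ᵥ
      ((Vb n M α * G * (Vb n M β)ᴴ) *ᵥ (Vb n M β *ᵥ A))).re ≤ Cst d a * (s α * s β) := by
    intro α β
    refine (Complex.re_le_norm _).trans ?_
    refine (norm_form_le _ _ _).trans ?_
    exact mul_le_mul_of_nonneg_right (opNorm_Vb_calG_VbH_le n hn M a ha α β)
      (mul_nonneg (hs0 α) (hs0 β))
  rw [hexp, Complex.re_sum]
  simp_rw [Complex.re_sum]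
  calc ∑ α, ∑ β, (star (Vb n M α *ᵥ A) ⬝ᵥ
          ((Vb n M α * G * (Vb n M β)ᴴ) *ᵥ (Vb n M β *ᵥ A))).re
        ≤ ∑ α, ∑ β, Cst d a * (s α * s β) :=
          Finset.sum_le_sum fun α _ => Finset.sum_le_sum fun β _ => hterm α β
    _ = Cst d a * (∑ α, s α) ^ 2 := by
          rw [sq, Finset.sum_mul_sum, Finset.mul_sum]
          refine Finset.sum_congr rfl fun α _ => ?_
          rw [Finset.mul_sum]
    _ ≤ Cst d a * ((Finset.univ : Finset (Option (Fin d))).card * ∑ α, s α ^ 2) :=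
          mul_le_mul_of_nonneg_left (sq_sum_le_card_mul_sum_sq (s := Finset.univ) (f := s))
            (Cst_nonneg d a)
    _ = ((d + 1 : ℝ) * Cst d a) * ∑ α, nsq (Vb n M α *ᵥ A) := by
          rw [Finset.card_univ, Fintype.card_option, Fintype.card_fin]
          simp_rw [hs2]
          push_cast
          ring

/-- THE KEY INEQUALITY `x^*(Δ+I)x ≤ (d+1)·Cst · re x^* 𝒟_a x`: Cauchy–Schwarz in the `𝒢`-inner
product (`𝒢 ≥ 0`, `𝒢𝒟_a = 1`) combined with the block estimate. [cite: Balaban1984PropagatorsI,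
(1.89) ⟹ (1.90) p.33 «This implies the bound from below» (proof ours)] -/
theorem form_LapOne_le (A : Tor (fine n M) × Fin d → ℂ) :
    ∑ α, nsq (Vb n M α *ᵥ A)
      ≤ ((d + 1 : ℝ) * Cst d a) * (star A ⬝ᵥ (calDa n hn M a ha *ᵥ A)).re := by
  set G := calG n hn M a ha with hG
  set D := calDa n hn M a ha with hD
  set B := Lap n M + 1 with hB
  have hGD : G * D = 1 := calG_mul_calDa n hn M a ha
  have hGh : G.IsHermitian := calG_isHermitian n hn M a ha
  have hDh : D.IsHermitian := calDa_isHermitian n hn M a ha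
  have hBh : B.IsHermitian := LapOne_isHermitian n M
  have hGpsd : G.PosSemidef := calG_posSemidef n hn M a ha
  have hDpsd : D.PosSemidef := calDa_posSemidef n hn M a ha
  set K := D *ᵥ A with hK
  set g : ℝ := ∑ α, nsq (Vb n M α *ᵥ A) with hg
  set f : ℝ := (star A ⬝ᵥ (D *ᵥ A)).re with hf
  have hA : G *ᵥ K = A := by rw [hK, Matrix.mulVec_mulVec, hGD, Matrix.one_mulVec]
  -- (i) `x^* B x = K^* 𝒢 (B x)`
  have e1 : star A ⬝ᵥ (B *ᵥ A) = star K ⬝ᵥ (G *ᵥ (B *ᵥ A)) := by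
    conv_lhs => rw [← hA]
    rw [Matrix.star_mulVec, hGh.eq, ← Matrix.dotProduct_mulVec, hA]
  -- (ii) `re K^* 𝒢 K = re x^* 𝒟_a x`
  have e2 : (star K ⬝ᵥ (G *ᵥ K)).re = f := by
    rw [hA, hK, Matrix.star_mulVec, hDh.eq, ← Matrix.dotProduct_mulVec]
  -- (iii) `(Bx)^* 𝒢 (Bx) = x^* (B𝒢B) x`
  have e3 : star (B *ᵥ A) ⬝ᵥ (G *ᵥ (B *ᵥ A)) = star A ⬝ᵥ ((B * G * B) *ᵥ A) := by
    rw [Matrix.star_mulVec, hBh.eq, ← Matrix.dotProduct_mulVec, Matrix.mulVec_mulVec,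
      Matrix.mulVec_mulVec]
  have h3 : (star (B *ᵥ A) ⬝ᵥ (G *ᵥ (B *ᵥ A))).re ≤ ((d + 1 : ℝ) * Cst d a) * g := by
    rw [e3]
    exact re_form_BGB_le n hn M a ha A
  have e4 : star A ⬝ᵥ (B *ᵥ A) = (g : ℂ) := form_LapOne n M A
  have hg0 : 0 ≤ g := Finset.sum_nonneg fun α _ => nsq_nonneg _
  have hf0 : 0 ≤ f := form_re_nonneg_of_posSemidef hDpsd A
  have hM0 : 0 ≤ (d + 1 : ℝ) * Cst d a := by
    have := Cst_nonneg d a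
    positivity
  -- Cauchy–Schwarz
  have cs := norm_sq_form_le_of_posSemidef hGpsd K (B *ᵥ A)
  rw [← e1, e4, Complex.norm_real, Real.norm_eq_abs, sq_abs, e2] at cs
  have main : g ^ 2 ≤ f * (((d + 1 : ℝ) * Cst d a) * g) :=
    cs.trans (mul_le_mul_of_nonneg_left h3 hf0)
  by_cases hgz : g = 0
  · rw [hgz]
    exact mul_nonneg hM0 hf0
  · have hgpos : 0 < g := lt_of_le_of_ne hg0 (Ne.symm hgz)
    nlinarith [main, hgpos, hf0, hM0]

/-- (1.90) as a quadratic-form inequality with OUR constant: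
`(1/((d+1) Cst(d,a))) · x^*(Σ_ν∇_ν^*∇_ν + 1)x ≤ re x^* 𝒟_a x` for every `x ∈ ℓ²(T_η; ℂ^d)`.
[cite: Balaban1984PropagatorsI, Prop. 1.1 (1.90) p.33 (kernel version; constant ours)] -/
theorem lowerBound_re (A : Tor (fine n M) × Fin d → ℂ) :
    (1 / ((d + 1 : ℝ) * Cst d a)) * (star A ⬝ᵥ ((Lap n M + 1) *ᵥ A)).re
      ≤ (star A ⬝ᵥ (calDa n hn M a ha *ᵥ A)).re := by
  rw [form_LapOne, Complex.ofReal_re]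
  have hM : 0 < (d + 1 : ℝ) * Cst d a := by
    have := one_le_Cst (d := d) a
    positivity
  rw [one_div, inv_mul_le_iff₀ hM]
  exact form_LapOne_le n hn M a ha A

/-- **(1.90) `Δ_a = G⁻¹ ≥ γ₀(Δ + I)` IN THE KERNEL (Löwner order, kernel version with our
constant `γ = 1/((d+1)·Cst(d,a))`, `Cst(d,a) = max(γ₀(d,a), 1/a, 1)` the (1.89) constant of pass 4):
`𝒟_a − γ (Σ_ν ∇_ν^*∇_ν + 1)` is positive semidefinite on `ℓ²(T_η; ℂ^d)`, uniformly in `η`, `T_η`.**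
[cite: Balaban1984PropagatorsI, Prop. 1.1 (1.90) p.33 (kernel version for the operator with
Fourier blocks (1.73)/(1.83); constant and proof ours)] -/
theorem calDa_sub_smul_LapOne_posSemidef :
    (calDa n hn M a ha - (((1 / ((d + 1 : ℝ) * Cst d a)) : ℝ) : ℂ) • (Lap n M + 1)).PosSemidef := by
  refine Matrix.PosSemidef.of_dotProduct_mulVec_nonneg ?_ fun A => ?_
  · refine (calDa_isHermitian n hn M a ha).sub ((LapOne_isHermitian n M).smul ?_)
    simp [IsSelfAdjoint, Complex.conj_ofReal]
  · rw [Matrix.sub_mulVec, dotProduct_sub, Matrix.smul_mulVec, dotProduct_smul, smul_eq_mul,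
      form_LapOne, form_eq_re_of_posSemidef (calDa_posSemidef n hn M a ha) A, ← Complex.ofReal_mul,
      ← Complex.ofReal_sub, Complex.zero_le_real, sub_nonneg]
    have h := lowerBound_re n hn M a ha A
    rwa [form_LapOne, Complex.ofReal_re] at h

open scoped MatrixOrder in
/-- (1.90) in the Löwner order on matrices: `γ (Δ + I) ≤ 𝒟_a`, `γ = 1/((d+1)·Cst(d,a))`.
[cite: Balaban1984PropagatorsI, Prop. 1.1 (1.90) p.33 (kernel version; constant ours)] -/
theorem smul_LapOne_le_calDa :
    (((1 / ((d + 1 : ℝ) * Cst d a)) : ℝ) : ℂ) • (Lap n M + 1) ≤ calDa n hn M a ha :=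
  Matrix.le_iff.mpr (calDa_sub_smul_LapOne_posSemidef n hn M a ha)

/-! ## §6 The `Δ` of (1.90) is the Fourier multiplier with symbol `Δ(p) = Σ_ν |∂_ν(p)|²` (1.31) -/

/-- the symbol `Δ(p) = Σ_ν |∂_ν(p)|²`, `∂_ν(p) = η⁻¹(e^{iηp_ν} − 1)`, of `Σ_ν ∇_ν^*∇_ν` on the fine
torus ((1.31), via `B5Prop11Plancherel.fsym`). [cite: Balaban1984PropagatorsI, (1.31) p.23] -/
def LapSym (i : Tor (fine n M) × Fin d) : ℝ := ∑ ν, ‖fsym (fine n M) (n : ℂ) ν i‖ ^ 2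

/-- `Σ_ν ∇_ν^*∇_ν = U^* diag(Δ(p)) U`: the operator `Δ` in (1.90) is multiplication by the symbol
(1.31) in momentum space. [cite: Balaban1984PropagatorsI, (1.31) p.23 (proof ours)] -/
theorem Lap_eq :
    Lap n M = star (dftV (fine n M)) * Matrix.diagonal (fun i => (LapSym n M i : ℂ))
      * dftV (fine n M) := by
  have hUU : dftV (fine n M) * star (dftV (fine n M)) = 1 := dftV_mul_star (fine n M)
  have hν : ∀ ν, (fdiff (fine n M) (n : ℂ) ν)ᴴ * fdiff (fine n M) (n : ℂ) ν
      = star (dftV (fine n M))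
        * Matrix.diagonal (fun i => ((‖fsym (fine n M) (n : ℂ) ν i‖ ^ 2 : ℝ) : ℂ))
        * dftV (fine n M) := by
    intro ν
    rw [← Matrix.star_eq_conjTranspose, star_fdiff_eq, fdiff_eq (fine n M) (n : ℂ) ν]
    calc star (dftV (fine n M)) * Matrix.diagonal (star (fsym (fine n M) (n : ℂ) ν))
          * dftV (fine n M)
          * (star (dftV (fine n M)) * Matrix.diagonal (fsym (fine n M) (n : ℂ) ν) * dftV (fine n M))
          = star (dftV (fine n M)) * Matrix.diagonal (star (fsym (fine n M) (n : ℂ) ν))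
            * (dftV (fine n M) * star (dftV (fine n M)))
            * Matrix.diagonal (fsym (fine n M) (n : ℂ) ν) * dftV (fine n M) := by
              simp only [Matrix.mul_assoc]
      _ = star (dftV (fine n M)) * (Matrix.diagonal (star (fsym (fine n M) (n : ℂ) ν))
            * Matrix.diagonal (fsym (fine n M) (n : ℂ) ν)) * dftV (fine n M) := by
              rw [hUU, Matrix.mul_one]
              simp only [Matrix.mul_assoc]
      _ = _ := by
              rw [Matrix.diagonal_mul_diagonal]
              congr 2
              refine congrArg Matrix.diagonal (funext fun i => ?_)
              simp only [Pi.star_apply, Complex.star_def]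
              rw [Complex.conj_mul' (fsym (fine n M) (n : ℂ) ν i)]
              push_cast
              rfl
  rw [Lap, Finset.sum_congr rfl fun ν _ => hν ν, ← Finset.sum_mul, ← Finset.mul_sum]
  congr 2
  ext i j
  rw [Matrix.sum_apply]
  by_cases h : i = j
  · subst h
    simp [LapSym]
  · simp [Matrix.diagonal_apply_ne _ h]

/-- on the coset `p = p′ + l` (`p = emb((k, μ), q)`), the symbol of `Σ_ν ∇_ν^*∇_ν` is
`Δ(p′ + l) = Σ_ν |∂_ν(p′+l)|²` — the very `Δ(p′+l)` entering the fibers (1.73)/(1.83)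
(`B5Prop11Fiber.Delta_eq`; `emb` = `B5Prop11Plancherel.emb`, the coset parametrisation). [cite: Balaban1984PropagatorsI, (1.31) p.23, (1.83) p.31] -/
theorem LapSym_emb (k : Fin d → Fin n) (μ : Fin d) (q : Tor M) :
    LapSym n M (B5Prop11Plancherel.emb n M ((k, μ), q)) = DeltaXir n 0 (shiftr n k (sOf M q)) := by
  simp only [LapSym, fsym_emb]
  exact (Delta_eq n k _).symm

end Operator

end

end Literature.MathematicalPhysics.QuantumFieldTheory.Balaban1983to89.B5Prop11Lower
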